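import Literature.MathematicalPhysics.QuantumFieldTheory.Balaban1983to89.B1Eq324BenfattoSect5LedgerDischargeUpper
import HarnessLib

/-!
# Benfatto et al. 1978, §5 — the LEDGER DISCHARGE, LOWER HALF: the closed (4.7) ledger inequality of `…Sect5LowerAssembly.ineq47_of_ledger`
# (with the Appendix-A term) from ONE free-field threshold, in the socket shape of `…Sect5BasicLemmaKnit.basicLemma_signed_of_ledgers` (LOWERPACK) — PROVED

doc: Literature/MathematicalPhysics/QuantumFieldTheory/Balaban1983to89/B1Eq324BenfattoLemma.md

WHY THIS MODULE (cell `pub-ymgap`, seat `dag-n08-c` gen 20; node N08 [Balaban1985UV3]).  Twin of `…Sect5LedgerDischargeUpper` for the LOWER pavement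
chain of §5 (cut-offs `γⁿb`, `n ≤ d`, Appendix A below `γ^{d+1}b`): the LOWER package of the ledger socket of `…Sect5BasicLemmaKnit`, for every
Appendix-A triple `(b̄, k₁, k₂)` with `k₁ ≥ 0 < k₂`, every `t, D, ϰ > 0`, all exponents `ρ₁ ≥ D+2d`, `ρ₂ ≥ 0`, `ρ₃ ≥ D+2d`, `ρ₄ ≥ 8·2^d·s₁(D) + 1` and
every threshold `b* ≥ γ^{−(d+1)}(|b̄|+1) + 6·2^d(d+1)!·(4/γ^{2d})^{d+1} + 10(d+1) + 1` (free of `t, D, ϰ` — print's «b* = max{10⁴, γ⁻³b̄}»).  Every loss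
of the closed lower ledger is bounded ATOM BY ATOM by the toolkit `…Sect5LedgerDischarge` / `…Sect5LedgerDischargeCumulant` (seat `dag-n08-b`) at the cut-off
`c = γⁿb ∈ [γ^d b, b]` and by `…ErrTermLedger.appendixA_term_le_snd`, in print's two regimes, and summed as in the upper twin.
[cite: BenfattoEtAl1978, Basic Lemma (4.7) p.152; §5 (5.33)–(5.35), «Collecting all the errors» p.159; b* p.159; Appendix A p.161]

## Theorems
* `cutoff_lower`, `params_lower` — parameter bookkeeping on the lower chain.
* `nsmul_shape_appA_le_errTerm` — the fold with the Appendix-A atom.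
* ★ `lowerpack` — LOWERPACK of the ledger socket.

HONEST SCOPE.  Elementary real analysis over displayed closed terms; no measure theory; count-neutral for N08; nothing of [Balaban1985UV3] (41)/(47)/(5) is
asserted; nothing about d = 4, the continuum, OS axioms, a mass gap or the Clay problem.
-/

noncomputable section

open Finset
open scoped BigOperators Nat

namespace Literature.MathematicalPhysics.QuantumFieldTheory.Balaban1983to89.B1Eq324BenfattoSect5LedgerDischargeLower

open Literature.MathematicalPhysics.QuantumFieldTheory.Balaban1983to89.B1Eq324BenfattoLemma
open Literature.MathematicalPhysics.QuantumFieldTheory.Balaban1983to89.B1Eq324BenfattoSect5ErrTermLedger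
open Literature.MathematicalPhysics.QuantumFieldTheory.Balaban1983to89.B1Eq324BenfattoSect5Eq511 (s1Const)
open Literature.MathematicalPhysics.QuantumFieldTheory.Balaban1983to89.B1Eq324GaussianMomentLeaf (momentConst)
open Literature.Probability.LatticeModels (setPartitions)
open Literature.MathematicalPhysics.QuantumFieldTheory.Balaban1983to89.B1Eq324BenfattoSect5LedgerDischarge
open Literature.MathematicalPhysics.QuantumFieldTheory.Balaban1983to89.B1Eq324BenfattoSect5LedgerDischargeCumulant
open Literature.MathematicalPhysics.QuantumFieldTheory.Balaban1983to89.B1Eq324BenfattoSect5LedgerDischargeUpper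
open Literature.MathematicalPhysics.QuantumFieldTheory.Balaban1983to89.B1Eq324BenfattoAppendixC2 (condCov_freeCov_nonneg_le)

variable {d : ℕ}

/-! ## §1  Parameter bookkeeping on the lower chain -/

section Params

variable {γ b : ℝ}

/-- The cut-offs of the LOWER chain, `c_n = γⁿb` (`n ≤ d`), and the next-box cut-off `γ·c_n`, lie in `[γ^d·b, 1·b]`.
[cite: BenfattoEtAl1978, p.159 «J replaced by Γ̄₁ and b by γb»] -/
theorem cutoff_lower (hγ0 : 0 < γ) (hγ1 : γ ≤ 1) (hb : 1 ≤ b) {n : ℕ} (hn : n ∈ Finset.range (d + 1)) :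
    0 ≤ γ ^ n * b ∧ γ ^ n * b ≤ 1 * b ∧ γ ^ d * b ≤ γ ^ n * b ∧ 0 ≤ γ * (γ ^ n * b) ∧ γ * (γ ^ n * b) ≤ 1 * b := by
  have hb0 : 0 ≤ b := by linarith
  have hnd : n ≤ d := by have := Finset.mem_range.mp hn; omega
  have hpn : 0 ≤ γ ^ n := pow_nonneg hγ0.le _
  have hle1 : γ ^ n ≤ 1 := pow_le_one₀ hγ0.le hγ1
  have hle : γ ^ d ≤ γ ^ n := pow_le_pow_of_le_one hγ0.le hγ1 hnd
  have h0 : 0 ≤ γ ^ n * b := mul_nonneg hpn hb0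
  have h1 : γ ^ n * b ≤ 1 * b := mul_le_mul_of_nonneg_right hle1 hb0
  refine ⟨h0, h1, mul_le_mul_of_nonneg_right hle hb0, by positivity, (mul_le_of_le_one_left h0 hγ1).trans h1⟩

/-- The `b`-dependent pavement parameters of the lower chain in print's two regimes (`L = ⌈b²⌉`, `v = V`, `w = 2V`) and every side condition of
`ineq47_of_ledger` from `b > γ^{−(d+1)}(|b̄|+1) + 6·2^d(d+1)!·(4/(γ^d)²)^{d+1} + 10(d+1) + 1` and `b₀ ≥ (10(d+1)(M+1))²`.
[cite: BenfattoEtAl1978, p.154 (ℓ ≈ b²), p.159 (b* = max{10⁴, γ⁻³b̄})] -/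
theorem params_lower {M b₀ bbar : ℝ} (hγ0 : 0 < γ) (hγ1 : γ ≤ 1) (hM : 0 < M) (hb₀ : (10 * ((d : ℝ) + 1) * (M + 1)) ^ 2 ≤ b₀)
    (hb : (γ ^ (d + 1))⁻¹ * (|bbar| + 1) + 6 * 2 ^ d * ((d + 1).factorial : ℝ) * (4 / (γ ^ d) ^ 2) ^ (d + 1) + 10 * (d + 1) + 1 < b) :
    ∃ L V : ℕ, 1 ≤ b ∧ ((L : ℝ) ≤ 2 * b ^ 2) ∧ (1 ≤ (L : ℝ)) ∧ 1 ≤ γ ^ (d + 1) * b ∧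
      ((L : ℝ) ^ d) * Real.exp (-((γ ^ d * b) ^ 2 / 4)) ≤ 1 / 6 ∧ bbar < γ ^ (d + 1) * b ∧
      1 ≤ V ∧ (b₀ ≤ b → M * b ^ (3 / 2 : ℝ) ≤ (V : ℝ)) ∧ (d + 1) * (2 * (2 * (2 * V) + V)) ≤ L := by
  have hg : 0 < γ ^ (d + 1) := pow_pos hγ0 _
  have hg1 : γ ^ (d + 1) ≤ 1 := pow_le_one₀ hγ0.le hγ1
  have hgd : 0 < γ ^ d := pow_pos hγ0 _
  have hfac : (1 : ℝ) ≤ ((d + 1).factorial : ℝ) := by exact_mod_cast Nat.succ_le_of_lt (Nat.factorial_pos _)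
  have hA0 : 0 ≤ 6 * 2 ^ d * ((d + 1).factorial : ℝ) * (4 / (γ ^ d) ^ 2) ^ (d + 1) := by positivity
  have habs : 0 ≤ |bbar| := abs_nonneg _
  have hinv1 : 1 ≤ (γ ^ (d + 1))⁻¹ := one_le_inv_iff₀.mpr ⟨hg, hg1⟩
  have hfirst : |bbar| + 1 ≤ (γ ^ (d + 1))⁻¹ * (|bbar| + 1) := le_mul_of_one_le_left (by positivity) hinv1
  have hb1 : 1 ≤ b := by nlinarith
  have hb0' : 0 ≤ b := by linarith
  have hbb : b ≤ b ^ 2 := by nlinarith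
  have hthr : 6 * 2 ^ d * ((d + 1).factorial : ℝ) * (4 / (γ ^ d) ^ 2) ^ (d + 1) ≤ b ^ 2 := by nlinarith
  have h10 : 10 * ((d : ℝ) + 1) ≤ b ^ 2 := by nlinarith
  have hgb : |bbar| + 1 < γ ^ (d + 1) * b := by
    have h1 : (γ ^ (d + 1))⁻¹ * (|bbar| + 1) < b := by nlinarith
    have h2 := mul_lt_mul_of_pos_left h1 hg
    rwa [← mul_assoc, mul_inv_cancel₀ hg.ne', one_mul] at h2
  refine ⟨⌈b ^ 2⌉₊, (if b₀ ≤ b then ⌈M * b ^ (3 / 2 : ℝ)⌉₊ else 1), hb1, natCeil_sq_le_two_mul_sq hb1, one_le_natCeil_sq hb1, by linarith, ?_,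
    lt_of_le_of_lt (le_abs_self bbar) (by linarith), one_le_regimeV hM hb1, fun h => wide_of_regime h, shifts_fit_regime hM.le hb₀ h10⟩
  exact natCeil_sq_pow_mul_exp_le (d := d) (b := b) (c := γ ^ d * b) (γ' := γ ^ d) hgd hb1 le_rfl hthr

end Params

/-! ## §2  The fold with the Appendix-A atom -/

section Algebra

/-- The final fold on the lower side: `m` equal per-step totals plus the Appendix-A atom `nI·(C_A·SND)` are at most `nI·errTerm X …` with
`X = max (max (m(C₁+C₂+Cc+Ce) + C_A) (m(C₁+C₂+Cc+Cr))) 0`. [cite: BenfattoEtAl1978, (4.7) p.152, (A.1)–(A.2) p.161] -/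
theorem nsmul_shape_appA_le_errTerm {m : ℕ} {nI C₁ C₂ Cr Ce Cc CA A b ρ₁ ρ₂ ρ₃ ρ₄ : ℝ} {t : ℕ} (hnI : 0 ≤ nI) (hA : 0 ≤ A) (hb : 0 ≤ b) :
    m • (nI * errTerm C₁ ρ₁ ρ₂ ρ₃ ρ₄ A b t + nI * errTerm C₂ ρ₁ ρ₂ ρ₃ ρ₄ A b t +
        (nI * (Cr * (A * b ^ ρ₁ * Real.exp (ρ₂ * A * b ^ ρ₃)) ^ (t + 1) + Ce * (Real.exp (-(ρ₃ * b ^ (3 / 2 : ℝ))) * Real.exp (ρ₄ * A * b ^ ρ₃))) +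
          nI * errTerm Cc ρ₁ ρ₂ ρ₃ ρ₄ A b t)) +
        nI * (CA * (Real.exp (-(ρ₃ * b ^ (3 / 2 : ℝ))) * Real.exp (ρ₄ * A * b ^ ρ₃))) ≤
      nI * errTerm (max (max ((m : ℝ) * (C₁ + C₂ + Cc + Ce) + CA) ((m : ℝ) * (C₁ + C₂ + Cc + Cr))) 0) ρ₁ ρ₂ ρ₃ ρ₄ A b t := by
  rw [nsmul_eq_mul]
  unfold errTerm
  set F : ℝ := (A * b ^ ρ₁ * Real.exp (ρ₂ * A * b ^ ρ₃)) ^ (t + 1) with hF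
  set S : ℝ := Real.exp (-(ρ₃ * b ^ (3 / 2 : ℝ))) * Real.exp (ρ₄ * A * b ^ ρ₃) with hS
  set X : ℝ := max (max ((m : ℝ) * (C₁ + C₂ + Cc + Ce) + CA) ((m : ℝ) * (C₁ + C₂ + Cc + Cr))) 0 with hX
  have hF0 : 0 ≤ F := by rw [hF]; positivity
  have hS0 : 0 ≤ S := by rw [hS]; positivity
  have hP : (m : ℝ) * (C₁ + C₂ + Cc + Ce) + CA ≤ X := (le_max_left _ _).trans (le_max_left _ _)
  have hR : (m : ℝ) * (C₁ + C₂ + Cc + Cr) ≤ X := (le_max_right _ _).trans (le_max_left _ _)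
  have heq : (m : ℝ) * (nI * (C₁ * (F + S)) + nI * (C₂ * (F + S)) + (nI * (Cr * F + Ce * S) + nI * (Cc * (F + S)))) + nI * (CA * S) =
      nI * (((m : ℝ) * (C₁ + C₂ + Cc + Ce) + CA) * S + (m : ℝ) * (C₁ + C₂ + Cc + Cr) * F) := by ring
  rw [heq]
  refine mul_le_mul_of_nonneg_left ?_ hnI
  calc ((m : ℝ) * (C₁ + C₂ + Cc + Ce) + CA) * S + (m : ℝ) * (C₁ + C₂ + Cc + Cr) * F ≤ X * S + X * F :=
        add_le_add (mul_le_mul_of_nonneg_right hP hS0) (mul_le_mul_of_nonneg_right hR hF0)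
    _ = X * (F + S) := by ring

end Algebra

/-! ## §3  LOWERPACK: the closed (4.7) ledger of `ineq47_of_ledger` from one free-field threshold -/

section Lower

variable {α β : ℝ}

set_option maxHeartbeats 1600000 in -- the conclusion is the ≈ 90-line closed ledger text of `…Sect5LowerAssembly.ineq47_of_ledger`; ≈ 15 atoms per (n, k)
/-- ★ **LOWERPACK — the LOWER half of the ledger socket of `…Sect5BasicLemmaKnit.basicLemma_signed_of_ledgers`, DISCHARGED.**  For `d ≥ 1`, `α, β > 0`, a
contraction `0 < γ ≤ 1`, an Appendix-A triple `(b̄, k₁, k₂)` with `k₁ ≥ 0 < k₂`, every `t, D`, `ϰ > 0`, all exponents with `ρ₁ ≥ D + 2d`, `ρ₂ ≥ 0`, `ρ₃ ≥ D + 2d`,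
`ρ₄ ≥ 8·2^d·s₁(D) + 1` and every threshold `b* ≥ γ^{−(d+1)}(|b̄|+1) + 6·2^d(d+1)!·(4/(γ^d)²)^{d+1} + 10(d+1) + 1` (free of `t, D, ϰ`): there are `S ≥ 0` and a rate
`0 < δ ≤ log((2d+α²)/2d)` with `δD²√d < ϰ` such that every `b > b*` admits `L, w, v` (`L = ⌈b²⌉`, `w = 2v`, `v = ⌈Mb^{3/2}⌉` resp. `1`) with `2(2w+v) < L`,
`(d+1)·2(2w+v) ≤ L`, `v ≤ w`, `1 ≤ w`, `1 ≤ γ^{d+1}b`, `L^d e^{−(γ^d b)²/4} ≤ 1/6`, `b̄ < γ^{d+1}b`, and — for all `s`, `nI ≥ 1`, `A ≥ 0` — the closed LOWER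
ledger inequality of `ineq47_of_ledger` (its `hledger` with `|I| ↦ nI`, `sup|coeff| ↦ A`) `≤ nI·errTerm S ρ₁ ρ₂ ρ₃ ρ₄ A b t`.  Proof: as the upper twin, at the
cut-offs `c = γⁿb ∈ [γ^d b, b]` (`Γ = 1`, `γ′ = γ^d`), plus `…ErrTermLedger.appendixA_term_le_snd` at `γ′ = γ^{d+1}`.
[cite: BenfattoEtAl1978, Basic Lemma (4.7) p.152; §5 (5.33)–(5.35), «Collecting all the errors» p.159; Appendix A p.161] -/
theorem lowerpack (hd : 0 < d) (hα : 0 < α) (hβ : 0 < β) {γ : ℝ} (hγ0 : 0 < γ) (hγ1 : γ ≤ 1)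
    {bbar k₁ k₂ : ℝ} (hk₁ : 0 ≤ k₁) (hk₂ : 0 < k₂)
    (t D : ℕ) {κ : ℝ} (hκ : 0 < κ) {ρ₁ ρ₂ ρ₃ ρ₄ : ℝ}
    (hρ₁ : (D : ℝ) + 2 * d ≤ ρ₁) (hρ₂ : 0 ≤ ρ₂) (hρ₃ : (D : ℝ) + 2 * d ≤ ρ₃)
    (hρ₄ : 8 * s1Const D D d κ * 1 ^ D * 2 ^ d + 1 ≤ ρ₄)
    {bstar : ℝ} (hbs : (γ ^ (d + 1))⁻¹ * (|bbar| + 1) + 6 * 2 ^ d * ((d + 1).factorial : ℝ) * (4 / (γ ^ d) ^ 2) ^ (d + 1) + 10 * (d + 1) + 1 ≤ bstar) :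
    ∃ S δ : ℝ, 0 ≤ S ∧ 0 < δ ∧ δ ≤ Real.log ((2 * d + α ^ 2) / (2 * d)) ∧ 0 < κ / 2 - δ / 2 * ((D : ℝ) ^ 2 * Real.sqrt d) ∧
      ∀ b : ℝ, bstar < b → ∃ L w v : ℕ, 2 * (2 * w + v) < L ∧ (d + 1) * (2 * (2 * w + v)) ≤ L ∧ v ≤ w ∧ 1 ≤ w ∧
        1 ≤ γ ^ (d + 1) * b ∧ ((L : ℝ) ^ d) * Real.exp (-((γ ^ d * b) ^ 2 / 4)) ≤ 1 / 6 ∧ bbar < γ ^ (d + 1) * b ∧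
        ∀ (s : ℕ) (nI A : ℝ), 1 ≤ nI → 0 ≤ A →
          ∑ n ∈ Finset.range (d + 1),
              (((s1Const s D d κ * A * (γ ^ n * b) ^ D * Real.exp (-(κ / 4 * w)) * nI
                + s1Const s D d κ * A * (γ ^ n * b) ^ D *
                  (Real.exp (-(κ / 4 * w)) * (nI * (L : ℝ) ^ d) + Real.exp (-(κ / 4 * v)) * (nI * (L : ℝ) ^ d))) : ℝ)
                + (nI * ((let M : ℝ := A * (L : ℝ) ^ d * ∑ p ∈ Finset.Icc 1 s, ((admissible p D).card : ℝ) *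
                  ((2 / (1 - Real.exp (-(κ / 2 / (p : ℕ) / Real.sqrt d))) * Real.exp (κ / 2 / (p : ℕ) / Real.sqrt d)) ^ d) ^ (p - 1)
              let Mt : ℝ := A * Real.exp (δ / 2 * ((D : ℝ) ^ 2 * d)) * (L : ℝ) ^ d * ∑ p ∈ Finset.Icc 1 s, ((admissible p D).card : ℝ) *
                  ((2 / (1 - Real.exp (-((κ / 2 - δ / 2 * ((D : ℝ) ^ 2 * Real.sqrt d)) / (p : ℕ) / Real.sqrt d))) *
                    Real.exp ((κ / 2 - δ / 2 * ((D : ℝ) ^ 2 * Real.sqrt d)) / (p : ℕ) / Real.sqrt d)) ^ d) ^ (p - 1)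
              let K : ℝ := 4 * (s1Const s D d κ * A * (γ ^ n * b) ^ D * (L : ℝ) ^ d)
              let ε : ℝ := s1Const s D d κ * A * (γ ^ n * b) ^ D * Real.exp (-(κ / 4 * v)) * (L : ℝ) ^ d
              let W : ℝ := 3 * (((L : ℝ) ^ d) * Real.exp (-((γ ^ n * b) ^ 2 / 4)))
              let cχ : ℕ → ℝ := fun k => 2 ^ k * ((∑ π ∈ setPartitions (univ : Finset (Fin k)), ((π.card - 1)! : ℝ)) *
                  ((min 1 (2 * ((L : ℝ) ^ d) * Real.exp (-((γ ^ n * b) ^ 2 / 4)))) ^ ((2 * k : ℕ) : ℝ)⁻¹ *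
                    ((1 + (1 + 2 * d / α ^ 2) * (γ * (γ ^ n * b))) ^ D * M * momentConst D (2 * k) (freeCov d α β 0 0).toNNReal) ^ k))
              let K₀ : ℝ := max (max 1 (freeCov d α β 0 0)) ((1 + 2 * d / α ^ 2) * (γ * (γ ^ n * b)))
              let ε₃₁ : ℝ := max (β * (2 * d * (freeCov d α β 0 0 * (2 * d / (2 * d + α ^ 2)) ^ (w - v))) *
                    (γ * (γ ^ n * b) * ((L : ℝ) ^ d * (1 + Real.sqrt d * ((L : ℝ) - 1)))))
                  (2 * d * freeCov d α β 0 0 * (2 * d / (2 * d + α ^ 2)) ^ (w - v) / α ^ 2)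
              let δ₂₉ : ℕ → ℝ := fun k => 2 ^ (k * D) * 2 ^ 2 ^ (k * D) * K₀ ^ (k * D) * Real.exp (-(δ / 2 * ((v : ℝ) + 1))) * Mt ^ k
              let δ₃₁ : ℕ → ℝ := fun k => M ^ k * (2 ^ (k * D) * 2 ^ 2 ^ (k * D) * ((k * D : ℕ) * K₀ ^ (k * D) * ε₃₁))
              let Err : ℝ := 2 * (2 ^ ((t + 1).choose 2) * K ^ (t + 1) / (t + 1)!) + Real.exp (2 * K) * W
                  + ∑ k ∈ Finset.range t,
                      (3 ^ (k + 1) * ((∑ π ∈ setPartitions (univ : Finset (Fin (k + 1))), ((π.card - 1)! : ℝ)) * (ε * K ^ k))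
                        + 3 ^ (k + 1) * (cχ (k + 1) + δ₂₉ (k + 1)) + 3 ^ (k + 1) * (cχ (k + 1) + δ₃₁ (k + 1))) / (k + 1)!
              Err) : ℝ)
                + (            ∑ k ∈ Finset.range t,
                ((2 ^ (k + 1) * (2 ^ ((k + 1) * D) * 2 ^ 2 ^ ((k + 1) * D) * (max 1 (freeCov d α β 0 0)) ^ ((k + 1) * D)) *
                ((A * Real.exp (δ / 2 * ((D : ℝ) ^ 2 * d)) *
                    Real.exp (-((κ / 2 - δ / 2 * ((D : ℝ) ^ 2 * Real.sqrt d)) / 2 * w))) * nI *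
                  ∑ p ∈ Finset.Icc 1 s, ((admissible p D).card : ℝ) *
                    ((2 / (1 - Real.exp (-((κ / 2 - δ / 2 * ((D : ℝ) ^ 2 * Real.sqrt d)) / 2 / (p : ℕ) / Real.sqrt d))) *
                      Real.exp ((κ / 2 - δ / 2 * ((D : ℝ) ^ 2 * Real.sqrt d)) / 2 / (p : ℕ) / Real.sqrt d)) ^ d) ^ (p - 1)) *
                (A * Real.exp (δ / 2 * ((D : ℝ) ^ 2 * d)) *
                  ((1 : ℝ) * (2 / (1 - Real.exp (-(δ / (2 * ((k + 1 : ℕ) : ℝ)) / Real.sqrt d))) * Real.exp (δ / (2 * ((k + 1 : ℕ) : ℝ)) / Real.sqrt d)) ^ d) *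
                  ∑ p ∈ Finset.Icc 1 s, ((admissible p D).card : ℝ) *
                    ((2 / (1 - Real.exp (-((κ / 2 - δ / 2 * ((D : ℝ) ^ 2 * Real.sqrt d)) / (p : ℕ) / Real.sqrt d))) *
                      Real.exp ((κ / 2 - δ / 2 * ((D : ℝ) ^ 2 * Real.sqrt d)) / (p : ℕ) / Real.sqrt d)) ^ d) ^ (p - 1)) ^ k
                + 2 ^ (k + 1) * (2 ^ ((k + 1) * D) * 2 ^ 2 ^ ((k + 1) * D) * (max 1 (freeCov d α β 0 0)) ^ ((k + 1) * D)) *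
              (nI * (A * Real.exp (δ / 2 * ((D : ℝ) ^ 2 * d)) * Real.exp (-((κ / 2 - δ / 2 * ((D : ℝ) ^ 2 * Real.sqrt d)) / 2 * v)) *
                (L : ℝ) ^ d * ∑ p ∈ Finset.Icc 1 s, ((admissible p D).card : ℝ) *
                    ((2 / (1 - Real.exp (-((κ / 2 - δ / 2 * ((D : ℝ) ^ 2 * Real.sqrt d)) / 2 / (p : ℕ) / Real.sqrt d))) *
                      Real.exp ((κ / 2 - δ / 2 * ((D : ℝ) ^ 2 * Real.sqrt d)) / 2 / (p : ℕ) / Real.sqrt d)) ^ d) ^ (p - 1))) *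
              (A * Real.exp (δ / 2 * ((D : ℝ) ^ 2 * d)) *
                (2 / (1 - Real.exp (-(δ / (2 * ((k + 1 : ℕ) : ℝ)) / Real.sqrt d))) * Real.exp (δ / (2 * ((k + 1 : ℕ) : ℝ)) / Real.sqrt d)) ^ d *
                ∑ p ∈ Finset.Icc 1 s, ((admissible p D).card : ℝ) *
                    ((2 / (1 - Real.exp (-((κ / 2 - δ / 2 * ((D : ℝ) ^ 2 * Real.sqrt d)) / (p : ℕ) / Real.sqrt d))) *
                      Real.exp ((κ / 2 - δ / 2 * ((D : ℝ) ^ 2 * Real.sqrt d)) / (p : ℕ) / Real.sqrt d)) ^ d) ^ (p - 1)) ^ k)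
                + (2 ^ (k + 1) * (2 ^ ((k + 1) * D) * 2 ^ 2 ^ ((k + 1) * D) * (max 1 (freeCov d α β 0 0)) ^ ((k + 1) * D)) *
                (A * Real.exp (δ / 2 * ((D : ℝ) ^ 2 * d)) * Real.exp (-((κ / 2 - δ / 2 * ((D : ℝ) ^ 2 * Real.sqrt d)) / 2 * w)) *
                  (nI * (L : ℝ) ^ d) * ∑ p ∈ Finset.Icc 1 s, ((admissible p D).card : ℝ) *
                    ((2 / (1 - Real.exp (-((κ / 2 - δ / 2 * ((D : ℝ) ^ 2 * Real.sqrt d)) / 2 / (p : ℕ) / Real.sqrt d))) *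
                      Real.exp ((κ / 2 - δ / 2 * ((D : ℝ) ^ 2 * Real.sqrt d)) / 2 / (p : ℕ) / Real.sqrt d)) ^ d) ^ (p - 1)) *
                (A * Real.exp (δ / 2 * ((D : ℝ) ^ 2 * d)) *
                  (2 / (1 - Real.exp (-(δ / (2 * ((k + 1 : ℕ) : ℝ)) / Real.sqrt d))) * Real.exp (δ / (2 * ((k + 1 : ℕ) : ℝ)) / Real.sqrt d)) ^ d *
                  ∑ p ∈ Finset.Icc 1 s, ((admissible p D).card : ℝ) *
                    ((2 / (1 - Real.exp (-((κ / 2 - δ / 2 * ((D : ℝ) ^ 2 * Real.sqrt d)) / (p : ℕ) / Real.sqrt d))) *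
                      Real.exp ((κ / 2 - δ / 2 * ((D : ℝ) ^ 2 * Real.sqrt d)) / (p : ℕ) / Real.sqrt d)) ^ d) ^ (p - 1)) ^ k
                + 2 ^ (k + 1) * (2 ^ ((k + 1) * D) * 2 ^ 2 ^ ((k + 1) * D) * (max 1 (freeCov d α β 0 0)) ^ ((k + 1) * D)) *
              (nI * (A * Real.exp (δ / 2 * ((D : ℝ) ^ 2 * d)) * Real.exp (-((κ / 2 - δ / 2 * ((D : ℝ) ^ 2 * Real.sqrt d)) / 2 * v)) *
                (L : ℝ) ^ d * ∑ p ∈ Finset.Icc 1 s, ((admissible p D).card : ℝ) *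
                    ((2 / (1 - Real.exp (-((κ / 2 - δ / 2 * ((D : ℝ) ^ 2 * Real.sqrt d)) / 2 / (p : ℕ) / Real.sqrt d))) *
                      Real.exp ((κ / 2 - δ / 2 * ((D : ℝ) ^ 2 * Real.sqrt d)) / 2 / (p : ℕ) / Real.sqrt d)) ^ d) ^ (p - 1))) *
              (A * Real.exp (δ / 2 * ((D : ℝ) ^ 2 * d)) *
                (2 / (1 - Real.exp (-(δ / (2 * ((k + 1 : ℕ) : ℝ)) / Real.sqrt d))) * Real.exp (δ / (2 * ((k + 1 : ℕ) : ℝ)) / Real.sqrt d)) ^ d *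
                ∑ p ∈ Finset.Icc 1 s, ((admissible p D).card : ℝ) *
                    ((2 / (1 - Real.exp (-((κ / 2 - δ / 2 * ((D : ℝ) ^ 2 * Real.sqrt d)) / (p : ℕ) / Real.sqrt d))) *
                      Real.exp ((κ / 2 - δ / 2 * ((D : ℝ) ^ 2 * Real.sqrt d)) / (p : ℕ) / Real.sqrt d)) ^ d) ^ (p - 1)) ^ k)
                + 2 ^ ((k + 1) * D) * 2 ^ 2 ^ ((k + 1) * D) * (max 1 (freeCov d α β 0 0)) ^ ((k + 1) * D) *
              (nI * (((k + 1 : ℕ) : ℝ) * (k : ℝ) *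
                ((A * Real.exp (δ / 2 * ((D : ℝ) ^ 2 * d)) * ((L : ℝ) ^ d * (2 / (1 - Real.exp (-(δ / (2 * ((k + 1 : ℕ) : ℝ)) / Real.sqrt d))) * Real.exp (δ / (2 * ((k + 1 : ℕ) : ℝ)) / Real.sqrt d)) ^ d) *
                    ∑ p ∈ Finset.Icc 1 s, ((admissible p D).card : ℝ) *
                    ((2 / (1 - Real.exp (-((κ / 2 - δ / 2 * ((D : ℝ) ^ 2 * Real.sqrt d)) / (p : ℕ) / Real.sqrt d))) *
                      Real.exp ((κ / 2 - δ / 2 * ((D : ℝ) ^ 2 * Real.sqrt d)) / (p : ℕ) / Real.sqrt d)) ^ d) ^ (p - 1)) * ((A * Real.exp (δ / 2 * ((D : ℝ) ^ 2 * d)) * Real.exp (-(δ / (2 * ((k + 1 : ℕ) : ℝ)) / 2 * ((w : ℝ) + v + 1))) * ((L : ℝ) ^ d * (2 / (1 - Real.exp (-(δ / (2 * ((k + 1 : ℕ) : ℝ)) / 2 / Real.sqrt d))) * Real.exp (δ / (2 * ((k + 1 : ℕ) : ℝ)) / 2 / Real.sqrt d)) ^ d) *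
                    ∑ p ∈ Finset.Icc 1 s, ((admissible p D).card : ℝ) *
                    ((2 / (1 - Real.exp (-((κ / 2 - δ / 2 * ((D : ℝ) ^ 2 * Real.sqrt d)) / (p : ℕ) / Real.sqrt d))) *
                      Real.exp ((κ / 2 - δ / 2 * ((D : ℝ) ^ 2 * Real.sqrt d)) / (p : ℕ) / Real.sqrt d)) ^ d) ^ (p - 1)) *
                   (A * Real.exp (δ / 2 * ((D : ℝ) ^ 2 * d)) * ((L : ℝ) ^ d * (2 / (1 - Real.exp (-(δ / (2 * ((k + 1 : ℕ) : ℝ)) / Real.sqrt d))) * Real.exp (δ / (2 * ((k + 1 : ℕ) : ℝ)) / Real.sqrt d)) ^ d) *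
                    ∑ p ∈ Finset.Icc 1 s, ((admissible p D).card : ℝ) *
                    ((2 / (1 - Real.exp (-((κ / 2 - δ / 2 * ((D : ℝ) ^ 2 * Real.sqrt d)) / (p : ℕ) / Real.sqrt d))) *
                      Real.exp ((κ / 2 - δ / 2 * ((D : ℝ) ^ 2 * Real.sqrt d)) / (p : ℕ) / Real.sqrt d)) ^ d) ^ (p - 1)) ^ (k - 1)))))
                + nI * ((3 : ℝ) ^ (k + 1) *
              (2 ^ ((k + 1) * D) * 2 ^ 2 ^ ((k + 1) * D) * (max 1 (freeCov d α β 0 0)) ^ ((k + 1) * D) *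
                  Real.exp (-(δ / 2 * ((v : ℝ) + 1))) *
                (A * Real.exp (δ / 2 * ((D : ℝ) ^ 2 * d)) * (L : ℝ) ^ d * ∑ p ∈ Finset.Icc 1 s, ((admissible p D).card : ℝ) *
                    ((2 / (1 - Real.exp (-((κ / 2 - δ / 2 * ((D : ℝ) ^ 2 * Real.sqrt d)) / (p : ℕ) / Real.sqrt d))) *
                      Real.exp ((κ / 2 - δ / 2 * ((D : ℝ) ^ 2 * Real.sqrt d)) / (p : ℕ) / Real.sqrt d)) ^ d) ^ (p - 1)) ^ (k + 1)))) / (k + 1)! : ℝ)))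
              + nI * (k₁ * Real.exp (-(k₂ * (γ ^ (d + 1) * b) ^ 2)))
            ≤ nI * errTerm S ρ₁ ρ₂ ρ₃ ρ₄ A b t := by
  -- §a  free-field / order constants
  have hd' : (0 : ℝ) < d := by exact_mod_cast hd
  have hκ0 : 0 ≤ κ := hκ.le
  have hρ₃0 : 0 ≤ ρ₃ := le_trans (by positivity) hρ₃
  have hρ31 : 0 ≤ ρ₃ + 1 := by linarith
  have hs1 : 0 ≤ s1Const D D d κ := s1Const_nonneg D D d hκ0
  have hΓ0 : (0 : ℝ) ≤ 1 := zero_le_one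
  have h8 : 0 ≤ 8 * s1Const D D d κ * 1 ^ D * 2 ^ d := by positivity
  have hρ₄1 : 1 ≤ ρ₄ := by linarith
  have hρ₄v : 8 * s1Const D D d κ * 1 ^ D * 2 ^ d ≤ ρ₄ := by linarith
  have hC00 : 0 ≤ freeCov d α β 0 0 :=
    (condCov_freeCov_nonneg_le hα hβ ∅ 0 0).1.trans (condCov_freeCov_nonneg_le hα hβ ∅ 0 0).2
  have hθ0 : 0 < 2 * (d : ℝ) / (2 * d + α ^ 2) := by positivity
  have hθ1 : 2 * (d : ℝ) / (2 * d + α ^ 2) < 1 := by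
    rw [div_lt_one (by positivity)]
    nlinarith [pow_pos hα 2]
  have hL₀ : 0 < Real.log ((2 * d + α ^ 2) / (2 * d)) := by
    apply Real.log_pos
    rw [lt_div_iff₀ (by positivity)]
    nlinarith [pow_pos hα 2]
  have hlogθ : -Real.log (2 * (d : ℝ) / (2 * d + α ^ 2)) = Real.log ((2 * d + α ^ 2) / (2 * d)) := by
    rw [← Real.log_inv, inv_div]
  -- §b  the rate `δ`
  obtain ⟨δ, hδ, hδle, hres⟩ : ∃ δ : ℝ, 0 < δ ∧ δ ≤ Real.log ((2 * d + α ^ 2) / (2 * d)) ∧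
      0 < κ / 2 - δ / 2 * ((D : ℝ) ^ 2 * Real.sqrt d) := by
    refine ⟨min (Real.log ((2 * d + α ^ 2) / (2 * d))) (κ / ((D : ℝ) ^ 2 * Real.sqrt d + 1)), lt_min hL₀ (by positivity),
      min_le_left _ _, ?_⟩
    set X : ℝ := (D : ℝ) ^ 2 * Real.sqrt d with hX
    have hX0 : 0 ≤ X := by positivity
    have h1 : min (Real.log ((2 * d + α ^ 2) / (2 * d))) (κ / (X + 1)) ≤ κ / (X + 1) := min_le_right _ _
    have h2 : κ / (X + 1) * X < κ := by
      have h3 : κ / (X + 1) * X = κ * (X / (X + 1)) := by ring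
      rw [h3]
      exact mul_lt_of_lt_one_right hκ ((div_lt_one (by positivity)).mpr (by linarith))
    nlinarith [mul_le_mul_of_nonneg_right h1 hX0]
  have hδ0 : 0 ≤ δ := hδ.le
  have hκ'0 : 0 ≤ κ / 2 - δ / 2 * ((D : ℝ) ^ 2 * Real.sqrt d) := hres.le
  -- §c  the corridor multiplier `M` and the regime threshold `b₀`
  obtain ⟨M, hM0, hMκ, hMκ', hMδ, hML, hMe⟩ := exists_M_upper hρ31 hκ hres hδ hL₀ t
  have hMθ : ρ₃ + 1 ≤ -Real.log (2 * (d : ℝ) / (2 * d + α ^ 2)) * M := by rw [hlogθ]; exact hML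
  obtain ⟨b₀, hb₀0, hb₀fit⟩ : ∃ b₀ : ℝ, 0 ≤ b₀ ∧ (10 * ((d : ℝ) + 1) * (M + 1)) ^ 2 ≤ b₀ := ⟨_, by positivity, le_rfl⟩
  -- §d  the witnesses `S` (by unification at the very end) and `δ`
  refine ⟨?S, δ, ?hS, hδ, hδle, hres, fun b hb => ?main⟩
  case main =>
    obtain ⟨L, V, hb1, hL2b, hL1, hgb1, hsmall, hbbar, hV1, hVreg, hfit⟩ :=
      params_lower (d := d) hγ0 hγ1 hM0 hb₀fit (lt_of_le_of_lt hbs hb)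
    have hb0 : 0 ≤ b := by linarith
    have hΓb : 1 ≤ 1 * b := by rw [one_mul]; exact hb1
    have hWreg : b₀ ≤ b → M * b ^ (3 / 2 : ℝ) ≤ ((2 * V : ℕ) : ℝ) := fun h => (hVreg h).trans (by push_cast; linarith)
    have hWVreg : b₀ ≤ b → M * b ^ (3 / 2 : ℝ) ≤ ((2 * V - V : ℕ) : ℝ) := by
      rw [show 2 * V - V = V by omega]; exact hVreg
    refine ⟨L, 2 * V, V, lt_of_succ_mul_le hd (by omega) hfit, hfit, by omega, by omega, hgb1, hsmall, hbbar,
      fun s nI A hnI hA => ?_⟩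
    have hnI0 : 0 ≤ nI := by linarith
    -- §e  cut-off facts on the lower chain (`c_n = γⁿb ∈ [γ^d b, b]`)
    have hcut := fun n (hn : n ∈ Finset.range (d + 1)) => cutoff_lower (d := d) hγ0 hγ1 hb1 hn
    have hvw : V ≤ 2 * V := by omega
    -- §f  STRUCTURAL atoms (module 2, §6)
    have T1 := fun n (hn : n ∈ Finset.range (d + 1)) =>
      struct₁_le (s := s) (D := D) (d := d) (t := t) (ρ₁ := ρ₁) (ρ₂ := ρ₂) (hκ := hκ0) (hA := hA) (hb := hb1) (hΓ := hΓ0) (hc := (hcut n hn).1)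
        (hcb := (hcut n hn).2.1) (hb₀ := hb₀0) (hρ₃ := hρ₃0) (hρ₄ := hρ₄1) (hN0 := hnI0) (hNle := le_refl nI) (hreg := hWreg) (hM := hMκ)
    have T2 := fun n (hn : n ∈ Finset.range (d + 1)) =>
      struct₂_le (s := s) (D := D) (d := d) (t := t) (ρ₁ := ρ₁) (ρ₂ := ρ₂) (hκ := hκ0) (hA := hA) (hb := hb1) (hΓ := hΓ0) (hc := (hcut n hn).1) (hcb := (hcut n hn).2.1)
        (hL := hL2b) (hvw := hvw) (hb₀ := hb₀0) (hρ₃ := hρ₃0) (hρ₄ := hρ₄1) (hnI := hnI0) (hN0 := mul_nonneg hnI0 (pow_nonneg (Nat.cast_nonneg L) d))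
        (hNle := le_refl (nI * ((L : ℕ) : ℝ) ^ d)) (hN'0 := hnI0) (hN'le := le_refl nI) (hreg := hVreg) (hM := hMκ)
    -- §g  PER-BOX atoms (module 1, §4) at the cut-off `c_n`
    have R := fun n (hn : n ∈ Finset.range (d + 1)) =>
      errPB_remainder_le (t := t) (s := s) (D := D) (d := d) (ρ₃ := ρ₃) (hκ := hκ0) (hA := hA) (hb := hb1) (hΓ := hΓ0) (hc := (hcut n hn).1)
        (hcb := (hcut n hn).2.1) (hL := hL2b) (hρ₁ := hρ₁) (hρ₂ := hρ₂)
    have Vol := fun n (hn : n ∈ Finset.range (d + 1)) =>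
      errPB_volume_le (s := s) (D := D) (d := d) (hκ := hκ0) (hA := hA) (hb := hb1) (hΓ := hΓ0) (hc := (hcut n hn).1) (hcb := (hcut n hn).2.1)
        (hL := hL2b) (hγ' := pow_pos hγ0 d) (hγc := (hcut n hn).2.2.1) (hρ₃ := hρ₃) (hρ₄ := hρ₄v)
    have Eps := fun n (hn : n ∈ Finset.range (d + 1)) (k : ℕ) =>
      errPB_eps_le (s := s) (D := D) (d := d) (hκ := hκ0) (hA := hA) (hb := hb1) (hΓ := hΓ0) (hc := (hcut n hn).1) (hcb := (hcut n hn).2.1)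
        (hL := hL2b) (hb₀ := hb₀0) (hρ₃ := hρ₃0) (hρ₄ := hρ₄1) (hreg := hVreg) (hM := hMκ) k
    have Chi := fun n (hn : n ∈ Finset.range (d + 1)) (k : ℕ) =>
      errPB_chi_le (s := s) (D := D) (d := d) (α := α) (c₀ := (freeCov d α β 0 0).toNNReal) (hκ := hκ0) (hA := hA) (hb := hb1) (hΓ := hΓ0)
        (hΓb := hΓb) (hc := (hcut n hn).1) (hcb := (hcut n hn).2.1) (hL1 := hL1) (hL := hL2b) (hγ0 := hγ0.le) (hγ1 := hγ1) (hγ' := pow_pos hγ0 d)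
        (hγc := (hcut n hn).2.2.1) (hρ₃ := hρ₃0) (hρ₄ := hρ₄1) k
    have D29 := fun n (hn : n ∈ Finset.range (d + 1)) (k : ℕ) =>
      errPB_d29_le (s := s) (D := D) (d := d) (α := α) (C00 := freeCov d α β 0 0) (hA := hA) (hb := hb1) (hΓ := hΓ0) (hc := (hcut n hn).1)
        (hcb := (hcut n hn).2.1) (hL := hL2b) (hγ1 := hγ1) (hδ := hδ0) (hκ' := hκ'0) (hb₀ := hb₀0) (hρ₃ := hρ₃0) (hρ₄ := hρ₄1) (hreg := hVreg)
        (hM := hMδ) k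
    have D31 := fun n (hn : n ∈ Finset.range (d + 1)) (k : ℕ) =>
      errPB_d31_le (s := s) (D := D) (d := d) (α := α) (hκ := hκ0) (hA := hA) (hb := hb1) (hΓ := hΓ0) (hc := (hcut n hn).1) (hcb := (hcut n hn).2.1)
        (hL1 := hL1) (hL := hL2b) (hγ0 := hγ0.le) (hγ1 := hγ1) (hβ := hβ.le) (hC00 := hC00) (hθ0 := hθ0) (hθ1 := hθ1) (hb₀ := hb₀0) (hρ₃ := hρ₃0)
        (hρ₄ := hρ₄1) (hreg := hWVreg) (hM := hMθ) k
    -- the `k`-sum of the per-box error and the whole per-box error `Err_n ≤ Cr·FST + (Cv + T)·SND`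
    have KS := fun n (hn : n ∈ Finset.range (d + 1)) =>
      (Finset.sum_le_sum fun k (_ : k ∈ Finset.range t) =>
        (div_le_div_of_nonneg_right
          (add_le_add (add_le_add (Eps n hn k)
            (mul_le_mul_of_nonneg_left (add_le_add (Chi n hn k) (D29 n hn k)) (pow_nonneg (by norm_num : (0 : ℝ) ≤ 3) (k + 1))))
            (mul_le_mul_of_nonneg_left (add_le_add (Chi n hn k) (D31 n hn k)) (pow_nonneg (by norm_num : (0 : ℝ) ≤ 3) (k + 1))))
          (Nat.cast_nonneg (k + 1)!)).trans_eq (three_div_eq _ _ _ _ _ _ _ _ _)).trans_eq (Finset.sum_mul _ _ _).symm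
    have T3 := fun n (hn : n ∈ Finset.range (d + 1)) =>
      mul_le_mul_of_nonneg_left ((add_le_add (add_le_add (R n hn) (Vol n hn)) (KS n hn)).trans_eq (err_shape_eq _ _ _ _ _)) hnI0
    -- §h  CUMULANT-SIDE atoms (module 2, §5): (a) (b) (c) (d)=(b) (e) (f)
    have Ca := fun (k : ℕ) =>
      cum_a_le (s := s) (D := D) (d := d) (t := t) (ρ₁ := ρ₁) (ρ₂ := ρ₂) (C00 := freeCov d α β 0 0) (hA := hA) (hb := hb1) (hL := hL2b) (hδ := hδ0) (hκ' := hκ'0) (hb₀ := hb₀0)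
        (hρ₃ := hρ₃0) (hρ₄ := hρ₄1) (hN0 := hnI0) (hNle := le_refl nI) (hreg := hWreg) (hM := hMκ') k
    have Cb := fun (k : ℕ) =>
      cum_b_le (s := s) (D := D) (d := d) (t := t) (ρ₁ := ρ₁) (ρ₂ := ρ₂) (C00 := freeCov d α β 0 0) (hA := hA) (hb := hb1) (hL := hL2b) (hδ := hδ0) (hκ' := hκ'0) (hb₀ := hb₀0)
        (hρ₃ := hρ₃0) (hρ₄ := hρ₄1) (hN0 := hnI0) (hNle := le_refl nI) (hreg := hVreg) (hM := hMκ') k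
    have Cc := fun (k : ℕ) =>
      cum_c_le (s := s) (D := D) (d := d) (t := t) (ρ₁ := ρ₁) (ρ₂ := ρ₂) (C00 := freeCov d α β 0 0) (hA := hA) (hb := hb1) (hL := hL2b) (hδ := hδ0) (hκ' := hκ'0) (hb₀ := hb₀0)
        (hρ₃ := hρ₃0) (hρ₄ := hρ₄1) (hnI := hnI0) (hNle := le_refl (nI * ((L : ℕ) : ℝ) ^ d)) (hreg := hWreg) (hM := hMκ') k
    have Ce := fun (k : ℕ) (hk : k ∈ Finset.range t) =>
      cum_e_le (s := s) (D := D) (d := d) (t := t) (ρ₁ := ρ₁) (ρ₂ := ρ₂) (C00 := freeCov d α β 0 0) (w := 2 * V) (hA := hA) (hb := hb1) (hL := hL2b) (hδ := hδ0) (hκ' := hκ'0) (hb₀ := hb₀0)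
        (hρ₃ := hρ₃0) (hρ₄ := hρ₄1) (hN0 := hnI0) (hNle := le_refl nI) (hreg := hVreg) (hM := hMe k (Finset.mem_range.mp hk))
    have Cf := fun (k : ℕ) =>
      cum_f_le (s := s) (D := D) (d := d) (t := t) (ρ₁ := ρ₁) (ρ₂ := ρ₂) (C00 := freeCov d α β 0 0) (hA := hA) (hb := hb1) (hL := hL2b) (hδ := hδ0) (hκ' := hκ'0) (hb₀ := hb₀0)
        (hρ₃ := hρ₃0) (hρ₄ := hρ₄1) (hN0 := hnI0) (hNle := le_refl nI) (hreg := hVreg) (hM := hMδ) k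
    have T4 :=
      (Finset.sum_le_sum fun k (hk : k ∈ Finset.range t) =>
        (div_le_div_of_nonneg_right
          (add_le_add (add_le_add (add_le_add (add_le_add (Ca k) (reassoc_b (Cb k))) (add_le_add (Cc k) (reassoc_b (Cb k)))) (Ce k hk)) (Cf k))
          (Nat.cast_nonneg (k + 1)!)).trans_eq (six_errTerm_div_eq _ _ _ _ _ _ _ _ _ _ _ _ _ _ _)).trans_eq (sum_mul_errTerm_eq _ _ _ _ _ _ _ _ _ _)
    -- §i  per step, then the `d + 1` steps, then the fold into `nI·errTerm S …`
    have hF := fun n (hn : n ∈ Finset.range (d + 1)) =>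
      add_le_add (add_le_add (T1 n hn) (T2 n hn)) (add_le_add (T3 n hn) T4)
    -- §j  the Appendix-A atom (module 0 `…ErrTermLedger.appendixA_term_le_snd` at `γ' = γ^{d+1}`) and the fold into `nI·errTerm S …`
    have TA := mul_le_mul_of_nonneg_left
      (appendixA_term_le_snd (ρ₃ := ρ₃) hk₁ hk₂ (pow_pos hγ0 (d + 1)) hb0 hA (le_trans zero_le_one hρ₄1)) hnI0
    have key := (add_le_add ((Finset.sum_le_sum hF).trans (Finset.sum_const _).le) TA).trans
      (nsmul_shape_appA_le_errTerm (t := t) hnI0 hA hb0)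
    dsimp only
    exact key
  case hS => exact le_max_right _ _

end Lower

end Literature.MathematicalPhysics.QuantumFieldTheory.Balaban1983to89.B1Eq324BenfattoSect5LedgerDischargeLower

end
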